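import Summits.Ventures.HodgeRepro2.T5SU11KernelBracket
import Summits.Ventures.HodgeRepro2.T5SU11SphericalDecayEdge
import Summits.Ventures.HodgeRepro2.T5SU11SphericalDecayEdgeAsymptotic
import Summits.Ventures.HodgeRepro2.T5SU11ResolventBoundaryEdge
import Summits.Ventures.HodgeRepro2.T5SU11GroundStateTransform
import Summits.Ventures.HodgeRepro2.T5SU11SphericalLpSharp

/-!
# The Lagrange integrals at the spectral edge: the decaying solution `χ_1` against `φ_λ`, `χ_λ`

Row 510's computation repeated with one of the two parameters at the bottom of the spectrum, `λ₂ = 1`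
(`μ₁ = 1·(1 − 2) = −1`, the ground state `Ξ = φ_1` and its decaying partner `χ_1 ~ (π/2) e^{−t}`, rows 480–481):

* `sphDecay'_one_eq` — `χ_1′ = Ξ′ T_1 − 1/(sinh 2t Ξ)`; `eventually_sphDecay_one_le` — `χ_1(t) ≤ π e^{−t}` eventually;
* **`tendsto_sinh_mul_sphDecay_one_mul_sphDecay'`** — `sinh 2R χ_1(R) χ_λ′(R) → 0` and
  **`tendsto_sinh_mul_sphDecay_mul_sphDecay'_one`** — `sinh 2R χ_λ(R) χ_1′(R) → 0` for every `λ > 1` (the rates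
  `χ_1 ≤ π e^{−R}`, `χ_λ ≤ 2L e^{−λR}`, `T_λ ≤ 2K e^{−2(λ−1)R}`, `T_1(R) ≤ T_1(1)`, `∫_0^R sinh 2u Ξ ≤ (α + βR) R e^R/2`,
  `Ξ ≥ e^{−R}`: every term is a polynomial times `e^{(1−λ)R}` or smaller), hence the mixed bracket
  `W(R) = sinh 2R (χ_1 χ_λ′ − χ_λ χ_1′) → 0` (`tendsto_bracket_sphDecay_one`);
* the auxiliary bounds `tailIntegral_sph_one_antitone` (`T_1(R) ≤ T_1(1)`), `integral_sinh_mul_sph_one_le`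
  (`∫_0^R sinh 2u Ξ ≤ (α + βR) R e^R/2`).

The Lagrange integrals with `χ_1` and the kernel resolvent identity at the edge are the next rows. Nothing is
claimed about (N).

Blind lane: Mathlib + the HodgeRepro2 prefix only; no sorry; axioms ⊆ {propext, Classical.choice,
Quot.sound}.
-/

namespace Summit.Ventures.HodgeRepro2.T5SU11KernelBracketEdge

open Filter Topology MeasureTheory intervalIntegral
open scoped Real
open Set (Ioi Ioc Icc Ioo)
open T5SU11Cartan T5SU11SphericalFunction T5SU11SphericalBounds T5SU11SphericalContinuous
  T5SU11SphericalSolutionSpaceAll T5SU11SphericalAsymptotic T5SU11SphericalCfun T5SU11SphericalDecay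
  T5SU11SphericalDecayAsymptotic T5SU11SphericalDecayBracket T5SU11ReductionOfOrder T5SU11ReductionOfOrderInfinity
  T5SU11ResolventBoundary T5SU11ResolventIdentity T5SU11GreenIdentityInhomogeneous
  T5SU11RadialGreenImproperDecaySource T5SU11KernelBracket T5SU11SphericalDecayEdge
  T5SU11SphericalDecayEdgeAsymptotic T5SU11ResolventBoundaryEdge T5SU11GroundStateTransform T5SU11SphericalLpSharp

section measure

variable [MeasurableSpace Circle] [BorelSpace Circle]

/-! ### `χ_1` and its derivative -/

/-- **`χ_1′ = Ξ′ T_1 − 1/(sinh 2t Ξ)`** on `(0, ∞)`. -/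
theorem sphDecay'_one_eq {t : ℝ} (ht : 0 < t) :
    sphDecay' 1 t = deriv (fun t => sph 1 (hyp t)) t * tailIntegral (fun t => sph 1 (hyp t)) t
      - (Real.sinh (2 * t) * sph 1 (hyp t))⁻¹ := by
  unfold sphDecay' decaySolution' secondSolution'
  rw [tailIntegral_eq (hφ_sph 1) (hpos_sph 1) integrableOn_roIntegrand_sph_one ht]
  ring

/-- `χ_1(t) ≤ π e^{−t}` eventually. -/
theorem eventually_sphDecay_one_le : ∀ᶠ t in atTop, sphDecay 1 t ≤ π * Real.exp (-t) := by
  have hπ := Real.pi_pos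
  have h := tendsto_exp_mul_sphDecay_one.eventually (eventually_le_nhds (by linarith : π / 2 < π))
  filter_upwards [h] with t ht
  have hE : 0 < Real.exp t := Real.exp_pos _
  rw [Real.exp_neg, ← div_eq_mul_inv, le_div_iff₀ hE, mul_comm]
  exact ht

/-- `T_1(R) ≤ T_1(1)` for `R ≥ 1` (the tail integral of a positive integrand decreases). -/
theorem tailIntegral_sph_one_antitone {R : ℝ} (hR : 1 ≤ R) :
    tailIntegral (fun t => sph 1 (hyp t)) R ≤ tailIntegral (fun t => sph 1 (hyp t)) 1 := by
  unfold tailIntegral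
  apply setIntegral_mono_set integrableOn_roIntegrand_sph_one
  · refine (ae_restrict_iff' measurableSet_Ioi).mpr (Eventually.of_forall fun s hs => ?_)
    unfold roIntegrand
    have h1 : 0 < Real.sinh (2 * s) := sinh_two_mul_pos (lt_trans one_pos hs)
    have h2 := sph_hyp_pos 1 s
    positivity
  · exact (Set.Ioi_subset_Ioi hR).eventuallyLE

/-- `T_1(R) ≥ 0` for `R > 0`. -/
theorem tailIntegral_sph_one_nonneg {R : ℝ} (hR : 0 < R) : 0 ≤ tailIntegral (fun t => sph 1 (hyp t)) R :=
  (tailIntegral_pos (hφ_sph 1) (hpos_sph 1) integrableOn_roIntegrand_sph_one hR).le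

/-- `∫_0^R sinh 2u Ξ(a_u) du ≤ (α + βR) R e^R / 2` for `R ≥ 0`, where `e^t Ξ(a_t) ≤ α + βt`. -/
theorem integral_sinh_mul_sph_one_le {α β : ℝ} (hα : 0 ≤ α) (hβ : 0 ≤ β)
    (hΞ : ∀ t, 0 ≤ t → Real.exp t * sph 1 (hyp t) ≤ α + β * t) {R : ℝ} (hR : 0 ≤ R) :
    ∫ u in (0 : ℝ)..R, Real.sinh (2 * u) * sph 1 (hyp u) ≤ (α + β * R) * R * Real.exp R / 2 := by
  have h := intervalIntegral.norm_integral_le_of_norm_le_const (a := (0 : ℝ)) (b := R)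
    (f := fun u => Real.sinh (2 * u) * sph 1 (hyp u)) (C := (α + β * R) * Real.exp R / 2) (fun u hu => ?_)
  · rw [Real.norm_eq_abs, sub_zero, abs_of_nonneg hR] at h
    calc ∫ u in (0 : ℝ)..R, Real.sinh (2 * u) * sph 1 (hyp u)
        ≤ |∫ u in (0 : ℝ)..R, Real.sinh (2 * u) * sph 1 (hyp u)| := le_abs_self _
      _ ≤ (α + β * R) * Real.exp R / 2 * R := h
      _ = (α + β * R) * R * Real.exp R / 2 := by ring
  · rw [Set.uIoc_of_le hR] at hu
    have hu0 : 0 < u := hu.1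
    have huR : u ≤ R := hu.2
    rw [Real.norm_eq_abs, abs_of_nonneg (sinh_mul_sph_hyp_nonneg 1 hu0.le)]
    have h1 : Real.sinh (2 * u) ≤ Real.exp (2 * u) / 2 := sinh_le_exp_div_two (2 * u)
    have h2 : sph 1 (hyp u) ≤ (α + β * u) * Real.exp (-u) := by
      have := hΞ u hu0.le
      have hE : 0 < Real.exp u := Real.exp_pos _
      rw [Real.exp_neg, ← div_eq_mul_inv, le_div_iff₀ hE, mul_comm]
      exact this
    have h3 : (α + β * u) ≤ α + β * R := by nlinarith
    have hE2 : Real.exp (2 * u) / 2 * Real.exp (-u) = Real.exp u / 2 := by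
      rw [show Real.exp (2 * u) = Real.exp u * Real.exp u by rw [← Real.exp_add]; congr 1; ring, Real.exp_neg]
      field_simp
    calc Real.sinh (2 * u) * sph 1 (hyp u)
        ≤ Real.exp (2 * u) / 2 * ((α + β * u) * Real.exp (-u)) :=
          mul_le_mul h1 h2 (sph_hyp_pos 1 u).le (by positivity)
      _ = (α + β * u) * (Real.exp (2 * u) / 2 * Real.exp (-u)) := by ring
      _ = (α + β * u) * (Real.exp u / 2) := by rw [hE2]
      _ ≤ (α + β * R) * (Real.exp R / 2) := by
          apply mul_le_mul h3 _ (by positivity) (by positivity)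
          exact div_le_div_of_nonneg_right (Real.exp_le_exp.mpr huR) two_pos.le
      _ = (α + β * R) * Real.exp R / 2 := by ring

variable {lam : ℝ} (hlam : 1 < lam)

/-! ### The mixed brackets at infinity -/

include hlam in
/-- **`sinh 2R · χ_1(R) χ_λ′(R) → 0`** for `λ > 1`. -/
theorem tendsto_sinh_mul_sphDecay_one_mul_sphDecay' :
    Tendsto (fun R => Real.sinh (2 * R) * (sphDecay 1 R * sphDecay' lam R)) atTop (𝓝 0) := by
  have hid : ∀ R, 0 < R → Real.sinh (2 * R) * (sphDecay 1 R * sphDecay' lam R)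
      = lam * (lam - 2) * (sphDecay 1 R * tailIntegral (fun t => sph lam (hyp t)) R
          * ∫ u in (0 : ℝ)..R, Real.sinh (2 * u) * sph lam (hyp u))
        - sphDecay 1 R / sph lam (hyp R) := by
    intro R hR
    have hφ : 0 < sph lam (hyp R) := sph_hyp_pos lam R
    have hs : 0 < Real.sinh (2 * R) := sinh_two_mul_pos hR
    rw [sphDecay'_eq hlam hR]
    have hdiv := sinh_mul_deriv_sph_hyp_eq lam R
    have e1 : Real.sinh (2 * R) * (Real.sinh (2 * R) * sph lam (hyp R))⁻¹ = (sph lam (hyp R))⁻¹ := by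
      rw [mul_inv, ← mul_assoc, mul_inv_cancel₀ hs.ne', one_mul]
    calc Real.sinh (2 * R) * (sphDecay 1 R * (deriv (fun t => sph lam (hyp t)) R
          * tailIntegral (fun t => sph lam (hyp t)) R - (Real.sinh (2 * R) * sph lam (hyp R))⁻¹))
        = sphDecay 1 R * tailIntegral (fun t => sph lam (hyp t)) R
            * (Real.sinh (2 * R) * deriv (fun t => sph lam (hyp t)) R)
          - sphDecay 1 R * (Real.sinh (2 * R) * (Real.sinh (2 * R) * sph lam (hyp R))⁻¹) := by ring
      _ = sphDecay 1 R * tailIntegral (fun t => sph lam (hyp t)) R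
            * (lam * (lam - 2) * ∫ u in (0 : ℝ)..R, Real.sinh (2 * u) * sph lam (hyp u))
          - sphDecay 1 R * (sph lam (hyp R))⁻¹ := by rw [hdiv, e1]
      _ = lam * (lam - 2) * (sphDecay 1 R * tailIntegral (fun t => sph lam (hyp t)) R
            * ∫ u in (0 : ℝ)..R, Real.sinh (2 * u) * sph lam (hyp u))
          - sphDecay 1 R / sph lam (hyp R) := by rw [div_eq_mul_inv]; ring
  have hπ := Real.pi_pos
  have hc : 0 < cfun (2 - lam) := cfun_pos (by linarith)
  -- `χ_1/φ_λ → 0`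
  have h2 : Tendsto (fun R => sphDecay 1 R / sph lam (hyp R)) atTop (𝓝 0) := by
    have hlim : Tendsto (fun R => 2 * π / cfun (2 - lam) * Real.exp (-(lam - 1) * R)) atTop (𝓝 0) := by
      have := (Real.tendsto_exp_neg_atTop_nhds_zero.comp (tendsto_id.const_mul_atTop (by linarith : 0 < lam - 1)))
        |>.const_mul (2 * π / cfun (2 - lam))
      rw [mul_zero] at this
      exact this.congr (fun R => by simp only [Function.comp_def, id]; ring_nf)
    refine squeeze_zero_norm' ?_ hlim
    filter_upwards [eventually_gt_atTop 0, eventually_sphDecay_one_le, eventually_le_sph_hyp hlam] with R hR hχ hφ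
    have hφ0 : 0 < sph lam (hyp R) := sph_hyp_pos lam R
    have hχ0 : 0 ≤ sphDecay 1 R := (sphDecay_one_pos hR).le
    rw [Real.norm_eq_abs, abs_of_nonneg (div_nonneg hχ0 hφ0.le), div_le_iff₀ hφ0]
    calc sphDecay 1 R ≤ π * Real.exp (-R) := hχ
      _ = 2 * π / cfun (2 - lam) * Real.exp (-(lam - 1) * R) * (cfun (2 - lam) / 2 * Real.exp ((lam - 2) * R)) := by
          rw [show Real.exp (-R) = Real.exp (-(lam - 1) * R) * Real.exp ((lam - 2) * R) by
            rw [← Real.exp_add]; congr 1; ring]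
          field_simp
      _ ≤ 2 * π / cfun (2 - lam) * Real.exp (-(lam - 1) * R) * sph lam (hyp R) :=
          mul_le_mul_of_nonneg_left hφ (by positivity)
  -- the first term
  have h1 : Tendsto (fun R => lam * (lam - 2) * (sphDecay 1 R * tailIntegral (fun t => sph lam (hyp t)) R
      * ∫ u in (0 : ℝ)..R, Real.sinh (2 * u) * sph lam (hyp u))) atTop (𝓝 0) := by
    set K := 1 / ((lam - 1) * cfun (2 - lam) ^ 2) with hK
    have hKpos : 0 < K := by positivity
    obtain ⟨C₀, hC₀, hC⟩ := exists_eventually_integral_sinh_sph_le hlam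
    have hT : ∀ᶠ R in atTop, tailIntegral (fun t => sph lam (hyp t)) R ≤ 2 * K * Real.exp (-(2 * (lam - 1)) * R) := by
      have h := (tendsto_exp_mul_tailIntegral_sph hlam).eventually (eventually_le_nhds (by linarith : K < 2 * K))
      filter_upwards [h] with R hR
      have hE : 0 < Real.exp (2 * (lam - 1) * R) := Real.exp_pos _
      rw [show Real.exp (-(2 * (lam - 1)) * R) = (Real.exp (2 * (lam - 1) * R))⁻¹ by
        rw [← Real.exp_neg]; congr 1; ring]
      rw [le_mul_inv_iff₀ hE, mul_comm]
      exact hR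
    have hlim : Tendsto (fun R => |lam * (lam - 2)| * (π * 2 * K
        * (C₀ * Real.exp (-(1 + 2 * (lam - 1)) * R)
          + cfun (2 - lam) * (R * Real.exp (-(lam - 1) * R))))) atTop (𝓝 0) := by
      have ha : Tendsto (fun R : ℝ => Real.exp (-(1 + 2 * (lam - 1)) * R)) atTop (𝓝 0) :=
        Real.tendsto_exp_neg_atTop_nhds_zero.comp (tendsto_id.const_mul_atTop (by linarith : 0 < 1 + 2 * (lam - 1)))
          |>.congr (fun R => by simp only [Function.comp_def, id]; ring_nf)
      have hb : Tendsto (fun R : ℝ => R * Real.exp (-(lam - 1) * R)) atTop (𝓝 0) :=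
        tendsto_mul_exp_neg_mul_atTop (by linarith)
      have := ((ha.const_mul C₀).add (hb.const_mul (cfun (2 - lam)))).const_mul (π * 2 * K)
        |>.const_mul |lam * (lam - 2)|
      simpa using this
    refine squeeze_zero_norm' ?_ hlim
    filter_upwards [eventually_gt_atTop 0, eventually_sphDecay_one_le, hT, hC] with R hR hχ hTR hCR
    have hχ0 : 0 ≤ sphDecay 1 R := (sphDecay_one_pos hR).le
    have hT0 : 0 ≤ tailIntegral (fun t => sph lam (hyp t)) R := tailIntegral_sph_nonneg hlam hR
    have hI0 : 0 ≤ ∫ u in (0 : ℝ)..R, Real.sinh (2 * u) * sph lam (hyp u) :=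
      intervalIntegral.integral_nonneg hR.le (fun u hu => sinh_mul_sph_hyp_nonneg lam hu.1)
    rw [Real.norm_eq_abs, abs_mul, abs_of_nonneg (by positivity : 0 ≤ sphDecay 1 R
      * tailIntegral (fun t => sph lam (hyp t)) R * ∫ u in (0 : ℝ)..R, Real.sinh (2 * u) * sph lam (hyp u))]
    apply mul_le_mul_of_nonneg_left _ (abs_nonneg _)
    calc sphDecay 1 R * tailIntegral (fun t => sph lam (hyp t)) R
          * ∫ u in (0 : ℝ)..R, Real.sinh (2 * u) * sph lam (hyp u)
        ≤ (π * Real.exp (-R)) * (2 * K * Real.exp (-(2 * (lam - 1)) * R))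
          * (C₀ + R * (cfun (2 - lam) * Real.exp (lam * R))) :=
          mul_le_mul (mul_le_mul hχ hTR hT0 (by positivity)) hCR hI0 (by positivity)
      _ = π * 2 * K * (C₀ * (Real.exp (-R) * Real.exp (-(2 * (lam - 1)) * R))
          + cfun (2 - lam) * (R * (Real.exp (-R) * Real.exp (-(2 * (lam - 1)) * R) * Real.exp (lam * R)))) := by
          ring
      _ = π * 2 * K * (C₀ * Real.exp (-(1 + 2 * (lam - 1)) * R)
          + cfun (2 - lam) * (R * Real.exp (-(lam - 1) * R))) := by
          have ea : Real.exp (-R) * Real.exp (-(2 * (lam - 1)) * R) = Real.exp (-(1 + 2 * (lam - 1)) * R) := by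
            rw [← Real.exp_add]; congr 1; ring
          have eb : Real.exp (-R) * Real.exp (-(2 * (lam - 1)) * R) * Real.exp (lam * R)
              = Real.exp (-(lam - 1) * R) := by
            rw [← Real.exp_add, ← Real.exp_add]; congr 1; ring
          rw [eb, ea]
  have h := h1.sub h2
  rw [sub_zero] at h
  refine h.congr' ?_
  filter_upwards [eventually_gt_atTop 0] with R hR
  exact (hid R hR).symm

include hlam in
/-- **`sinh 2R · χ_λ(R) χ_1′(R) → 0`** for `λ > 1`. -/
theorem tendsto_sinh_mul_sphDecay_mul_sphDecay'_one :
    Tendsto (fun R => Real.sinh (2 * R) * (sphDecay lam R * sphDecay' 1 R)) atTop (𝓝 0) := by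
  have hid : ∀ R, 0 < R → Real.sinh (2 * R) * (sphDecay lam R * sphDecay' 1 R)
      = -(sphDecay lam R * tailIntegral (fun t => sph 1 (hyp t)) R
          * ∫ u in (0 : ℝ)..R, Real.sinh (2 * u) * sph 1 (hyp u))
        - sphDecay lam R / sph 1 (hyp R) := by
    intro R hR
    have hφ : 0 < sph 1 (hyp R) := sph_hyp_pos 1 R
    have hs : 0 < Real.sinh (2 * R) := sinh_two_mul_pos hR
    rw [sphDecay'_one_eq hR]
    have hdiv := sinh_mul_deriv_sph_hyp_eq 1 R
    have e1 : Real.sinh (2 * R) * (Real.sinh (2 * R) * sph 1 (hyp R))⁻¹ = (sph 1 (hyp R))⁻¹ := by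
      rw [mul_inv, ← mul_assoc, mul_inv_cancel₀ hs.ne', one_mul]
    calc Real.sinh (2 * R) * (sphDecay lam R * (deriv (fun t => sph 1 (hyp t)) R
          * tailIntegral (fun t => sph 1 (hyp t)) R - (Real.sinh (2 * R) * sph 1 (hyp R))⁻¹))
        = sphDecay lam R * tailIntegral (fun t => sph 1 (hyp t)) R
            * (Real.sinh (2 * R) * deriv (fun t => sph 1 (hyp t)) R)
          - sphDecay lam R * (Real.sinh (2 * R) * (Real.sinh (2 * R) * sph 1 (hyp R))⁻¹) := by ring
      _ = sphDecay lam R * tailIntegral (fun t => sph 1 (hyp t)) R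
            * (1 * (1 - 2) * ∫ u in (0 : ℝ)..R, Real.sinh (2 * u) * sph 1 (hyp u))
          - sphDecay lam R * (sph 1 (hyp R))⁻¹ := by rw [hdiv, e1]
      _ = -(sphDecay lam R * tailIntegral (fun t => sph 1 (hyp t)) R
            * ∫ u in (0 : ℝ)..R, Real.sinh (2 * u) * sph 1 (hyp u))
          - sphDecay lam R / sph 1 (hyp R) := by rw [div_eq_mul_inv]; ring
  set L := 1 / ((lam - 1) * cfun (2 - lam)) with hL
  have hLpos : 0 < L := sphDecay_limit_pos hlam
  -- `χ_λ/Ξ → 0`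
  have h2 : Tendsto (fun R => sphDecay lam R / sph 1 (hyp R)) atTop (𝓝 0) := by
    have hlim : Tendsto (fun R => 2 * L * Real.exp (-(lam - 1) * R)) atTop (𝓝 0) := by
      have := (Real.tendsto_exp_neg_atTop_nhds_zero.comp (tendsto_id.const_mul_atTop (by linarith : 0 < lam - 1)))
        |>.const_mul (2 * L)
      rw [mul_zero] at this
      exact this.congr (fun R => by simp only [Function.comp_def, id]; ring_nf)
    refine squeeze_zero_norm' ?_ hlim
    filter_upwards [eventually_gt_atTop 0, eventually_sphDecay_le hlam] with R hR hχ
    have hφ0 : 0 < sph 1 (hyp R) := sph_hyp_pos 1 R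
    have hχ0 : 0 ≤ sphDecay lam R := (sphDecay_pos hlam hR).le
    have hΞ : Real.exp (-(1 * R)) ≤ sph 1 (hyp R) := exp_neg_mul_le_sph_hyp zero_le_one hR.le
    rw [Real.norm_eq_abs, abs_of_nonneg (div_nonneg hχ0 hφ0.le), div_le_iff₀ hφ0]
    calc sphDecay lam R ≤ 2 * L * Real.exp (-lam * R) := hχ
      _ = 2 * L * Real.exp (-(lam - 1) * R) * Real.exp (-(1 * R)) := by
          rw [show Real.exp (-lam * R) = Real.exp (-(lam - 1) * R) * Real.exp (-(1 * R)) by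
            rw [← Real.exp_add]; congr 1; ring]
          ring
      _ ≤ 2 * L * Real.exp (-(lam - 1) * R) * sph 1 (hyp R) := mul_le_mul_of_nonneg_left hΞ (by positivity)
  -- the first term
  have h1 : Tendsto (fun R => -(sphDecay lam R * tailIntegral (fun t => sph 1 (hyp t)) R
      * ∫ u in (0 : ℝ)..R, Real.sinh (2 * u) * sph 1 (hyp u))) atTop (𝓝 0) := by
    obtain ⟨α, β, hα, hβ, hΞ⟩ := exists_exp_mul_sph_one_hyp_le
    set T1 := tailIntegral (fun t => sph 1 (hyp t)) 1 with hT1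
    have hT1pos : 0 < T1 := tailIntegral_pos (hφ_sph 1) (hpos_sph 1) integrableOn_roIntegrand_sph_one one_pos
    have hlim : Tendsto (fun R => 2 * L * T1 / 2 * (α * (R * Real.exp (-(lam - 1) * R))
        + β * (R ^ 2 * Real.exp (-(lam - 1) * R)))) atTop (𝓝 0) := by
      have ha : Tendsto (fun R : ℝ => R * Real.exp (-(lam - 1) * R)) atTop (𝓝 0) :=
        tendsto_mul_exp_neg_mul_atTop (by linarith)
      have hb : Tendsto (fun R : ℝ => R ^ 2 * Real.exp (-(lam - 1) * R)) atTop (𝓝 0) :=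
        tendsto_pow_mul_exp_neg_mul_atTop 2 (by linarith)
      have := ((ha.const_mul α).add (hb.const_mul β)).const_mul (2 * L * T1 / 2)
      simpa using this
    refine squeeze_zero_norm' ?_ hlim
    filter_upwards [eventually_ge_atTop 1, eventually_sphDecay_le hlam] with R hR hχ
    have hR0 : 0 < R := lt_of_lt_of_le one_pos hR
    have hχ0 : 0 ≤ sphDecay lam R := (sphDecay_pos hlam hR0).le
    have hT0 : 0 ≤ tailIntegral (fun t => sph 1 (hyp t)) R := tailIntegral_sph_one_nonneg hR0
    have hTR : tailIntegral (fun t => sph 1 (hyp t)) R ≤ T1 := tailIntegral_sph_one_antitone hR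
    have hI0 : 0 ≤ ∫ u in (0 : ℝ)..R, Real.sinh (2 * u) * sph 1 (hyp u) :=
      intervalIntegral.integral_nonneg hR0.le (fun u hu => sinh_mul_sph_hyp_nonneg 1 hu.1)
    have hIR := integral_sinh_mul_sph_one_le hα hβ hΞ hR0.le
    rw [Real.norm_eq_abs, abs_neg, abs_of_nonneg (by positivity : 0 ≤ sphDecay lam R
      * tailIntegral (fun t => sph 1 (hyp t)) R * ∫ u in (0 : ℝ)..R, Real.sinh (2 * u) * sph 1 (hyp u))]
    calc sphDecay lam R * tailIntegral (fun t => sph 1 (hyp t)) R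
          * ∫ u in (0 : ℝ)..R, Real.sinh (2 * u) * sph 1 (hyp u)
        ≤ (2 * L * Real.exp (-lam * R)) * T1 * ((α + β * R) * R * Real.exp R / 2) :=
          mul_le_mul (mul_le_mul hχ hTR hT0 (by positivity)) hIR hI0 (by positivity)
      _ = 2 * L * T1 / 2 * (α * (R * (Real.exp (-lam * R) * Real.exp R))
          + β * (R ^ 2 * (Real.exp (-lam * R) * Real.exp R))) := by ring
      _ = 2 * L * T1 / 2 * (α * (R * Real.exp (-(lam - 1) * R)) + β * (R ^ 2 * Real.exp (-(lam - 1) * R))) := by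
          rw [show Real.exp (-lam * R) * Real.exp R = Real.exp (-(lam - 1) * R) by
            rw [← Real.exp_add]; congr 1; ring]
  have h := h1.sub h2
  rw [sub_zero] at h
  refine h.congr' ?_
  filter_upwards [eventually_gt_atTop 0] with R hR
  exact (hid R hR).symm

include hlam in
/-- **The mixed bracket `W(R) = sinh 2R (χ_1 χ_λ′ − χ_λ χ_1′) → 0`** as `R → ∞`. -/
theorem tendsto_bracket_sphDecay_one :
    Tendsto (fun R => Real.sinh (2 * R) * (sphDecay 1 R * sphDecay' lam R - sphDecay lam R * sphDecay' 1 R))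
      atTop (𝓝 0) := by
  have h := (tendsto_sinh_mul_sphDecay_one_mul_sphDecay' hlam).sub (tendsto_sinh_mul_sphDecay_mul_sphDecay'_one hlam)
  rw [sub_zero] at h
  refine h.congr (fun R => ?_)
  ring

end measure

end Summit.Ventures.HodgeRepro2.T5SU11KernelBracketEdge
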